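import Literature.MathematicalPhysics.QuantumFieldTheory.King1986.CovarianceRateTorus
import Summits.QuantumFields.YangMills.Theorems.UnitScaleTiltFluctuationComparisonRegPrTwoCutoffSymbolHeightFree
import HarnessLib

/-!
# `UnitScaleTiltFluctuationComparisonRegPrTwoCutoffOperatorHeightFree` — THE HEIGHT-FREE REFERENCE OPERATOR: on every unit torus King's block-RG effective Laplacians
# `Δ^{(k)}` CONVERGE (`k → ∞`) to ONE symmetric positive-semidefinite operator `Δ^{(∞)}`, entrywise within `θ̄·a·L^{−2k}` and in quadratic form within the RELATIVE
# budget `θ̄·L^{−2k}·⟨φ, Δ^{(k)}φ⟩` — hypothesis-free, zero mode included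
# (crux `FluctuationComparisonRegPrIntL`, stmt-QuantumFields-20520, STUB 3⁗χ; cell `pub/ym-inputs`, INPUT-LIST I-11 row p10 «K-uniform two-cut-off propagator estimate behind
# `FlatKernelLegCauchyΦ`»; seat ym-inputs-p10, file 2, count-neutral helper, def-free)

WHY.  File 1 (`…TwoCutoffSymbolHeightFree`, ✓ p618709) turned [King1986] Lemma 4.3 ∕ Prop. 3.10 — a TWO-RUN statement uniform in the number of extra slices — into the PER-RUN
REFERENCE FORM that the K1a architecture of 3⁗χ records ((R1) `KernelRefOwnΦ` against a height-free `Ψ`, `…GlobalSlackKernelLegRef(Own)`), at the SYMBOL layer and away from the zero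
mode (`lemma43_aK` needs `p′ ≠ 0`).  This file completes the bottom layer of the flat `A = 0` template on the finite unit torus `Ω = Π_μ ℤ∕M_μ`, for King's ACTUAL operators
`Δ^{(k)} = effLaplacian (L^k) M (a_k) (L^{2k}) m²` of `King1986.EffectiveLaplacianSymbol` ((2.13)–(2.14) p.653, (4.5) p.670):

* §1 `exists_limit_of_uniform_cauchy` — the analysis lemma behind both files: a real sequence with `|s_k − s_{k+n}| ≤ b_k ≤ C·r^k` (`0 ≤ r < 1`) for all `k, n ≥ 1` converges, and
  its limit `x` obeys the PER-INDEX bound `|s_k − x| ≤ b_k` for every `k ≥ 1` (completeness of `ℝ`, closedness along `n → ∞`);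
* §2 the ZERO MODE and the whole zone (`Δ^{(k)}(p′) > 0` everywhere is the tree's `King1986.DeltaEff_pos'`): `abs_DeltaEff_zero_sub_le_rel` (at `p′ = 0`:
  `|Δ^{(k)}(0) − Δ^{(k+n)}(0)| ≤ a·a_min⁻¹·L^{−2k}·Δ^{(k)}(0)`, `a_min = a(1 − L⁻²)`, from `Δ^{(k)}(0) = (a_k⁻¹ + m⁻²)⁻¹` and `a_{k+n}⁻¹ = a_k⁻¹ + L^{−2k}a_n⁻¹`),
  **`abs_DeltaEff_sub_le_rel`** (the RELATIVE two-run rate `θ̄·L^{−2k}·Δ^{(k)}(p′)`, `θ̄ = thetaBar a L = 2a(a_min⁻¹ + π²∕48 + 1∕3)`, at EVERY zone momentum incl. `0`, `m² > 0`),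
  **`exists_heightFree_symbol`** (∃ `Δ^{(∞)}(p′) ∈ [0, a]`, convergence, per-run relative rate — file 1's `exists_heightFree_limit` now on the whole zone);
* §3 OPERATORS: `effLaplacian_twoRun_apply_le` (entrywise two-run bound `θ̄·a·L^{−2k}` on EVERY torus — the tree's `effLaplacian_sub_apply_le` is stated on `Π ℤ∕(LM_μ)`),
  `tendsto_dotProduct_mulVec` (forms follow entries), `effLaplacian_form_nonneg`, `effLaplacian_form_twoRun_le` (RELATIVE two-run rate of the quadratic forms, via the
  plane-wave form (4.35) `effLaplacian_form_DeltaEff` and §2 mode by mode), and the capstone **`exists_heightFree_operator`**: ONE matrix `Δ^{(∞)}` on `Ω`, symmetric, with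
  `Δ^{(k)}(z,w) → Δ^{(∞)}(z,w)`, `|Δ^{(k)}(z,w) − Δ^{(∞)}(z,w)| ≤ θ̄·a·L^{−2k}`, `⟨φ,Δ^{(k)}φ⟩ → ⟨φ,Δ^{(∞)}φ⟩ ≥ 0` and `|⟨φ,Δ^{(k)}φ⟩ − ⟨φ,Δ^{(∞)}φ⟩| ≤ θ̄·L^{−2k}·⟨φ,Δ^{(k)}φ⟩`
  for every `k ≥ 1` and every `φ` — [King1986] Prop. 3.10 ∕ (3.92) in REFERENCE form for the actual operators.

HONEST FRAMING.  Flat, abelian, `A = 0`, periodic boundary conditions, `m² > 0` — the setting in which the tree reproduces [King1986] §4 (cell pub-balaban, `King1986/*`); a limit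
theorem assembled from the tree's PROVED `abs_DeltaEff_sub_le_thetaK`, `thetaK_le`, `effLaplacian_form_DeltaEff`, `effLaplacian_symm`, `abs_sub_apply_le_of_symbols`, `DeltaEff_zero`,
`inv_aK_add` and file 1.  It is NOT the non-abelian `d = 3` two-cut-off statement for Bałaban's `G_k(Ω; U₀)` (no carrier in the tree, unprinted — INPUT-LIST I-11, KILL-TEST E2 = NO)
and touches neither the stub, the crux nor the (α) record; nothing of [Balaban1985UV3] ∕ [King1986] is asserted.  YM₃ on T³ is a ladder rung, not the Clay problem ∕ 𝕋⁴ ∕ a mass gap;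
no summit or sub-problem statement is proved here.

References: C. King, CMP 102 (1986) 649–677 [King1986] ((2.13)–(2.14) p.653, Prop. 3.6 (3.56) p.662, Prop. 3.10 (3.91)–(3.92) p.669, (4.5) p.670, Lemma 4.3 (4.18) p.672, (4.35)
p.674; p.657 «is a Cauchy sequence and converges to a unique limit»).
-/

set_option autoImplicit false

noncomputable section

open Filter Topology Real Finset Matrix
open scoped BigOperators
open Literature.MathematicalPhysics.QuantumFieldTheory.Balaban1983to89
open Literature.MathematicalPhysics.QuantumFieldTheory.Balaban1983to89.B5Prop11Plancherel
open Literature.MathematicalPhysics.QuantumFieldTheory.King1986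
open Literature.MathematicalPhysics.QuantumFieldTheory.King1986.Torus

namespace Summit.QuantumFields.YangMills.Theorems.TwoCutoffOperatorHeightFree

/-! ## §1 The analysis lemma: uniform two-run bounds give a limit and a per-index bound -/

/-- **UNIFORM CAUCHY ⟹ LIMIT WITH THE SAME PER-INDEX BUDGET**: if `|s_k − s_{k+n}| ≤ b_k` for all `k, n ≥ 1` with `b_k ≤ C·r^k`, `0 ≤ r < 1`, then `s` converges to some `x`
and `|s_k − x| ≤ b_k` for every `k ≥ 1` (King p.657: «Hence {Z^{ε_K}} is a Cauchy sequence and converges to a unique limit»). [cite: King1986, (3.13) p.657] -/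
theorem exists_limit_of_uniform_cauchy {s b : ℕ → ℝ} {C r : ℝ} (hr1 : r < 1)
    (hb : ∀ k : ℕ, 1 ≤ k → b k ≤ C * r ^ k) (h : ∀ k n : ℕ, 1 ≤ k → 1 ≤ n → |s k - s (k + n)| ≤ b k) :
    ∃ x : ℝ, Tendsto s atTop (𝓝 x) ∧ ∀ k : ℕ, 1 ≤ k → |s k - x| ≤ b k := by
  have hCS : CauchySeq fun m : ℕ => s (m + 1) := by
    refine cauchySeq_of_le_geometric r (C * r) hr1 fun m => ?_
    rw [Real.dist_eq]
    have h1 := h (m + 1) 1 (by omega) le_rfl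
    calc |s (m + 1) - s (m + 1 + 1)| ≤ b (m + 1) := h1
      _ ≤ C * r ^ (m + 1) := hb (m + 1) (by omega)
      _ = C * r * r ^ m := by ring
  obtain ⟨x, hx1⟩ := cauchySeq_tendsto_of_complete hCS
  have hx : Tendsto s atTop (𝓝 x) := (tendsto_add_atTop_iff_nat (f := s) 1).mp hx1
  refine ⟨x, hx, fun k hk => ?_⟩
  have hshift : Tendsto (fun n : ℕ => s (k + n)) atTop (𝓝 x) := by
    have h2 := (tendsto_add_atTop_iff_nat (f := s) k).mpr hx
    refine h2.congr fun n => ?_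
    simp only [Nat.add_comm n k]
  have habs : Tendsto (fun n : ℕ => |s k - s (k + n)|) atTop (𝓝 |s k - x|) := (tendsto_const_nhds.sub hshift).abs
  refine le_of_tendsto habs ?_
  filter_upwards [eventually_ge_atTop 1] with n hn
  exact h k n hk hn

/-- Limits are unique: the reference is determined by the sequence. [folklore] -/
theorem limit_unique {s : ℕ → ℝ} {x y : ℝ} (hx : Tendsto s atTop (𝓝 x)) (hy : Tendsto s atTop (𝓝 y)) : x = y :=
  tendsto_nhds_unique hx hy

/-! ## §2 The zero mode and the whole Brillouin zone (symbols, `m² > 0`) -/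

section Symbols

variable {dd : ℕ}

/-- The level symbol lies in `(0, a]` at every `p′`, `k ≥ 1`. [cite: King1986, Prop. 3.10 p.669] -/
theorem levelSymbol_pos_le_zone {a : ℝ} (ha : 0 < a) {L : ℕ} (hL : 2 ≤ L) {m2 : ℝ} (hm : 0 ≤ m2) (p : Fin dd → ℝ) {k : ℕ} (hk : 1 ≤ k) :
    0 < DeltaEff (aK a L k) (L ^ k) m2 p ∧ DeltaEff (aK a L k) (L ^ k) m2 p ≤ a := by
  have hL1 : (1 : ℝ) < L := by exact_mod_cast hL
  have hak : 0 < aK a L k := aK_pos ha hL1 hk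
  exact ⟨DeltaEff_pos' hak (L ^ k) hm p, (DeltaEff_le hak (L ^ k) hm p).trans (aK_le ha hL1 hk)⟩

/-- `a·a_min⁻¹ ≤ θ̄` (`θ̄ = 2a(a_min⁻¹ + π²∕48 + 1∕3)`). [folklore] -/
theorem a_mul_inv_aminL_le_thetaBar {a : ℝ} (ha : 0 < a) {L : ℕ} (hL : 2 ≤ L) : a * (aminL a L)⁻¹ ≤ thetaBar a L := by
  unfold thetaBar
  have h0 : 0 ≤ (aminL a L)⁻¹ := (inv_pos.mpr (aminL_pos ha hL)).le
  nlinarith [Real.pi_pos]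

/-- File 1's constant IS `θ̄`: `2a((a(1 − L⁻²))⁻¹ + π²∕48 + 1∕3) = thetaBar a L`. [folklore] -/
theorem const_eq_thetaBar (a : ℝ) (L : ℕ) : 2 * a * ((a * (1 - ((L : ℝ) ^ 2)⁻¹))⁻¹ + π ^ 2 / 48 + 1 / 3) = thetaBar a L := by
  unfold thetaBar aminL; ring

/-- **THE ZERO MODE, RELATIVE RATE**: for `L ≥ 2`, `k, n ≥ 1`, `a > 0`, `m² > 0`,
`|Δ^{(k)}(0) − Δ^{(k+n)}(0)| ≤ a·a_min⁻¹·L^{−2k}·Δ^{(k)}(0)` — from `Δ^{(k)}(0) = (a_k⁻¹ + m⁻²)⁻¹` (`DeltaEff_zero`) and `a_{k+n}⁻¹ = a_k⁻¹ + L^{−2k}a_n⁻¹` (`inv_aK_add`):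
the difference is `Δ^{(k)}(0)·L^{−2k}a_n⁻¹·Δ^{(k+n)}(0)` and `Δ^{(k+n)}(0) ≤ a_{k+n} ≤ a`, `a_n ≥ a_min`. [cite: King1986, (2.13) p.653, (4.5) p.670, Lemma 4.3 (4.18) p.672] -/
theorem abs_DeltaEff_zero_sub_le_rel {a : ℝ} (ha : 0 < a) {L k n : ℕ} [NeZero L] (hL : 2 ≤ L) (hk : 1 ≤ k) (hn : 1 ≤ n) {m2 : ℝ} (hm : 0 < m2) :
    |DeltaEff (aK a L k) (L ^ k) m2 (0 : Fin dd → ℝ) - DeltaEff (aK a L (k + n)) (L ^ (k + n)) m2 (0 : Fin dd → ℝ)|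
      ≤ a * (aminL a L)⁻¹ * (((L : ℝ) ^ k) ^ 2)⁻¹ * DeltaEff (aK a L k) (L ^ k) m2 (0 : Fin dd → ℝ) := by
  have hL1 : (1 : ℝ) < L := by exact_mod_cast hL
  rw [DeltaEff_zero, DeltaEff_zero]
  have hak : 0 < aK a L k := aK_pos ha hL1 hk
  have han : 0 < aK a L n := aK_pos ha hL1 hn
  set u : ℝ := (aK a L k)⁻¹ with hu
  set δ : ℝ := ((L : ℝ) ^ (2 * k))⁻¹ * (aK a L n)⁻¹ with hδ
  have hu0 : 0 < u := inv_pos.mpr hak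
  have hδ0 : 0 ≤ δ := by positivity
  have hm0 : 0 < m2⁻¹ := inv_pos.mpr hm
  have hrel : (aK a L (k + n))⁻¹ = u + δ := inv_aK_add ha hL1 k n
  rw [hrel]
  have hX : 0 < u + m2⁻¹ := by positivity
  have hY : 0 < u + δ + m2⁻¹ := by positivity
  have hdiff : (u + m2⁻¹)⁻¹ - (u + δ + m2⁻¹)⁻¹ = (u + m2⁻¹)⁻¹ * δ * (u + δ + m2⁻¹)⁻¹ := by
    field_simp
    ring
  have hnn : 0 ≤ (u + m2⁻¹)⁻¹ - (u + δ + m2⁻¹)⁻¹ := by rw [hdiff]; positivity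
  rw [abs_of_nonneg hnn, hdiff]
  -- `(u + δ + m⁻²)⁻¹ ≤ (u + δ)⁻¹ = a_{k+n} ≤ a`
  have h1 : (u + δ + m2⁻¹)⁻¹ ≤ a := by
    have huδ0 : 0 < u + δ := by positivity
    have hle : (u + δ + m2⁻¹)⁻¹ ≤ (u + δ)⁻¹ := inv_anti₀ huδ0 (by linarith)
    have huδ : (u + δ)⁻¹ = aK a L (k + n) := by rw [← hrel, inv_inv]
    rw [huδ] at hle
    exact hle.trans (aK_le ha hL1 (by omega))
  -- `δ ≤ a_min⁻¹·L^{−2k}`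
  have h2 : δ ≤ (aminL a L)⁻¹ * (((L : ℝ) ^ k) ^ 2)⁻¹ := by
    have hinv : (aK a L n)⁻¹ ≤ (aminL a L)⁻¹ := inv_anti₀ (aminL_pos ha hL) (aminL_le_aK ha hL hn).1
    have hpw : ((L : ℝ) ^ k) ^ 2 = (L : ℝ) ^ (2 * k) := by rw [← pow_mul, mul_comm]
    rw [hpw]
    calc δ = ((L : ℝ) ^ (2 * k))⁻¹ * (aK a L n)⁻¹ := rfl
      _ ≤ ((L : ℝ) ^ (2 * k))⁻¹ * (aminL a L)⁻¹ := mul_le_mul_of_nonneg_left hinv (by positivity)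
      _ = (aminL a L)⁻¹ * ((L : ℝ) ^ (2 * k))⁻¹ := by ring
  have hX' : 0 ≤ (u + m2⁻¹)⁻¹ := (inv_pos.mpr hX).le
  calc (u + m2⁻¹)⁻¹ * δ * (u + δ + m2⁻¹)⁻¹
      ≤ (u + m2⁻¹)⁻¹ * ((aminL a L)⁻¹ * (((L : ℝ) ^ k) ^ 2)⁻¹) * a :=
        mul_le_mul (mul_le_mul_of_nonneg_left h2 hX') h1 (inv_pos.mpr hY).le (mul_nonneg hX' (by
          have := (inv_pos.mpr (aminL_pos ha hL)).le; positivity))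
    _ = a * (aminL a L)⁻¹ * (((L : ℝ) ^ k) ^ 2)⁻¹ * (u + m2⁻¹)⁻¹ := by ring

/-- **THE RELATIVE TWO-RUN RATE ON THE WHOLE ZONE (zero mode included)**: for `L ≥ 2`, `k, n ≥ 1`, `a > 0`, `m² > 0`, `p′ ∈ [−π, π]^d`,
`|Δ^{(k)}(p′) − Δ^{(k+n)}(p′)| ≤ θ̄·L^{−2k}·Δ^{(k)}(p′)`, `θ̄ = thetaBar a L` — file 1's `abs_sub_le_uniform` off the zero mode, `abs_DeltaEff_zero_sub_le_rel` at it.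
[cite: King1986, Lemma 4.3 (4.18) p.672; Prop. 3.10 (3.91) p.669] -/
theorem abs_DeltaEff_sub_le_rel {a : ℝ} (ha : 0 < a) {L k n : ℕ} [NeZero L] (hL : 2 ≤ L) (hk : 1 ≤ k) (hn : 1 ≤ n) {m2 : ℝ} (hm : 0 < m2)
    {p : Fin dd → ℝ} (hp : ∀ μ, |p μ| ≤ π) :
    |DeltaEff (aK a L k) (L ^ k) m2 p - DeltaEff (aK a L (k + n)) (L ^ (k + n)) m2 p|
      ≤ thetaBar a L * (((L : ℝ) ^ k) ^ 2)⁻¹ * DeltaEff (aK a L k) (L ^ k) m2 p := by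
  by_cases hp0 : p = 0
  · subst hp0
    refine (abs_DeltaEff_zero_sub_le_rel ha hL hk hn hm).trans ?_
    have hΔ : 0 ≤ DeltaEff (aK a L k) (L ^ k) m2 (0 : Fin dd → ℝ) := (levelSymbol_pos_le_zone ha hL hm.le 0 hk).1.le
    have hx : 0 ≤ (((L : ℝ) ^ k) ^ 2)⁻¹ := by positivity
    exact mul_le_mul_of_nonneg_right (mul_le_mul_of_nonneg_right (a_mul_inv_aminL_le_thetaBar ha hL) hx) hΔ
  · have h := TwoCutoffSymbolHeightFree.abs_sub_le_uniform ha hL hm.le hp (momSq_pos_of_ne_zero hp0) hk hn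
    rw [const_eq_thetaBar] at h
    exact h

/-- **THE HEIGHT-FREE REFERENCE SYMBOL ON THE WHOLE ZONE** (`m² > 0`; file 1's `exists_heightFree_limit` extended to the zero mode): for every `p′ ∈ [−π, π]^d` there is
`Δ^{(∞)}(p′) ∈ [0, a]` with `Δ^{(k)}(p′) → Δ^{(∞)}(p′)` and `|Δ^{(k)}(p′) − Δ^{(∞)}(p′)| ≤ θ̄·L^{−2k}·Δ^{(k)}(p′)` for every `k ≥ 1`.
[cite: King1986, Prop. 3.10 (3.91) p.669; Prop. 3.6 (3.56) p.662 with (3.58)-(3.61) p.663] -/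
theorem exists_heightFree_symbol {a : ℝ} (ha : 0 < a) {L : ℕ} [NeZero L] (hL : 2 ≤ L) {m2 : ℝ} (hm : 0 < m2) {p : Fin dd → ℝ} (hp : ∀ μ, |p μ| ≤ π) :
    ∃ Δinf : ℝ, 0 ≤ Δinf ∧ Δinf ≤ a ∧
      Tendsto (fun k : ℕ => DeltaEff (aK a L k) (L ^ k) m2 p) atTop (𝓝 Δinf) ∧
      ∀ k : ℕ, 1 ≤ k → |DeltaEff (aK a L k) (L ^ k) m2 p - Δinf| ≤ thetaBar a L * (((L : ℝ) ^ k) ^ 2)⁻¹ * DeltaEff (aK a L k) (L ^ k) m2 p := by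
  have hL1 : (1 : ℝ) < L := by exact_mod_cast hL
  have hr1 : ((L : ℝ) ^ 2)⁻¹ < 1 := inv_lt_one_of_one_lt₀ (by nlinarith)
  have hθ : 0 ≤ thetaBar a L := by
    unfold thetaBar; have := (inv_pos.mpr (aminL_pos ha hL)).le; positivity
  obtain ⟨x, hx, hrate⟩ := exists_limit_of_uniform_cauchy (s := fun k : ℕ => DeltaEff (aK a L k) (L ^ k) m2 p)
    (b := fun k => thetaBar a L * (((L : ℝ) ^ k) ^ 2)⁻¹ * DeltaEff (aK a L k) (L ^ k) m2 p) (C := thetaBar a L * a) (r := ((L : ℝ) ^ 2)⁻¹) hr1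
    (fun k hk => by
      obtain ⟨-, hle⟩ := levelSymbol_pos_le_zone ha hL hm.le p hk
      have hx : (((L : ℝ) ^ k) ^ 2)⁻¹ = (((L : ℝ) ^ 2)⁻¹) ^ k := by rw [← pow_mul, mul_comm, pow_mul, inv_pow]
      rw [hx]
      have hr : 0 ≤ (((L : ℝ) ^ 2)⁻¹) ^ k := by positivity
      calc thetaBar a L * (((L : ℝ) ^ 2)⁻¹) ^ k * DeltaEff (aK a L k) (L ^ k) m2 p ≤ thetaBar a L * (((L : ℝ) ^ 2)⁻¹) ^ k * a :=
            mul_le_mul_of_nonneg_left hle (mul_nonneg hθ hr)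
        _ = thetaBar a L * a * (((L : ℝ) ^ 2)⁻¹) ^ k := by ring)
    (fun k n hk hn => abs_DeltaEff_sub_le_rel ha hL hk hn hm hp)
  refine ⟨x, ?_, ?_, hx, hrate⟩
  · exact ge_of_tendsto hx (by filter_upwards [eventually_ge_atTop 1] with k hk; exact (levelSymbol_pos_le_zone ha hL hm.le p hk).1.le)
  · exact le_of_tendsto hx (by filter_upwards [eventually_ge_atTop 1] with k hk; exact (levelSymbol_pos_le_zone ha hL hm.le p hk).2)

end Symbols

/-! ## §3 The operators on the unit torus -/

section Operators

variable {d : ℕ}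

/-- **ENTRYWISE TWO-RUN BOUND ON EVERY TORUS**: for `L ≥ 2`, `k, n ≥ 1`, `a > 0`, `m² > 0`, every torus `Ω = Π ℤ∕M_μ` and all `z, w`,
`|Δ^{(k)}(z,w) − Δ^{(k+n)}(z,w)| ≤ θ̄·a·L^{−2k}` — the tree's `abs_sub_apply_le_of_symbols` (polarization + Parseval) fed with the plane-wave forms (4.35) of both operators
and the mode-by-mode bound `abs_DeltaEff_sub_le_thetaK` ∘ `thetaK_le`. [cite: King1986, Lemma 4.3 (4.18) p.672, (4.35) p.674] -/
theorem effLaplacian_twoRun_apply_le {a m2 : ℝ} (ha : 0 < a) (hm : 0 < m2) {L k n : ℕ} [NeZero L] (hL : 2 ≤ L) (hk : 1 ≤ k) (hn : 1 ≤ n)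
    (M : Fin d → ℕ) [∀ μ, NeZero (M μ)] (z w : Tor M) :
    |effLaplacian (L ^ k) M (aK a L k) (((L ^ k : ℕ) : ℝ) ^ 2) m2 z w
        - effLaplacian (L ^ (k + n)) M (aK a L (k + n)) (((L ^ (k + n) : ℕ) : ℝ) ^ 2) m2 z w|
      ≤ thetaBar a L * a * (((L : ℝ) ^ k) ^ 2)⁻¹ := by
  have hL1 : (1 : ℝ) < L := by exact_mod_cast hL
  have hN₁ : 1 ≤ L ^ k := Nat.one_le_pow k L (by omega)
  have hN₀ : 1 ≤ L ^ (k + n) := Nat.one_le_pow (k + n) L (by omega)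
  have ha₁ : 0 < aK a L k := aK_pos ha hL1 hk
  have ha₀ : 0 < aK a L (k + n) := aK_pos ha hL1 (by omega)
  refine abs_sub_apply_le_of_symbols M _ _
    (effLaplacian_symm (L ^ k) M _ _ _) (effLaplacian_symm (L ^ (k + n)) M _ _ _)
    (fun q => DeltaEff (aK a L k) (L ^ k) m2 (sOf M q))
    (fun q => DeltaEff (aK a L (k + n)) (L ^ (k + n)) m2 (sOf M q))
    (effLaplacian_form_DeltaEff (L ^ k) M hN₁ ha₁ hm)
    (effLaplacian_form_DeltaEff (L ^ (k + n)) M hN₀ ha₀ hm)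
    (fun q => ?_) z w
  have h := abs_DeltaEff_sub_le_thetaK (m2 := m2) ha hL hk hn hm (fun μ => abs_sOf_le M q μ)
  rw [show L ^ n * L ^ k = L ^ (k + n) by rw [pow_add, mul_comm]] at h
  refine h.trans ?_
  exact (mul_le_mul_of_nonneg_right (thetaK_le ha hL hk hn) ha.le).trans (le_of_eq (by ring))

/-- **QUADRATIC FORMS FOLLOW ENTRIES**: if `T_k(z,w) → T_∞(z,w)` for all `z, w` then `⟨φ, T_kψ⟩ → ⟨φ, T_∞ψ⟩` (finite sums). [folklore] -/
theorem tendsto_dotProduct_mulVec {ι : Type*} [Fintype ι] {T : ℕ → Matrix ι ι ℝ} {Tinf : Matrix ι ι ℝ}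
    (h : ∀ z w, Tendsto (fun k => T k z w) atTop (𝓝 (Tinf z w))) (φ ψ : ι → ℝ) :
    Tendsto (fun k => φ ⬝ᵥ (T k *ᵥ ψ)) atTop (𝓝 (φ ⬝ᵥ (Tinf *ᵥ ψ))) := by
  show Tendsto (fun k => ∑ i, φ i * ∑ j, T k i j * ψ j) atTop (𝓝 (∑ i, φ i * ∑ j, Tinf i j * ψ j))
  refine tendsto_finsetSum _ fun i _ => ?_
  refine Tendsto.const_mul _ (tendsto_finsetSum _ fun j _ => ?_)
  exact (h i j).mul_const _

/-- **THE FORMS ARE NONNEGATIVE**: `0 ≤ ⟨φ, Δ^{(k)}φ⟩` (`k ≥ 1`, `m² > 0`) — the plane-wave form (4.35) is a sum of nonnegative terms. [cite: King1986, (4.35) p.674] -/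
theorem effLaplacian_form_nonneg {a m2 : ℝ} (ha : 0 < a) (hm : 0 < m2) {L k : ℕ} [NeZero L] (hL : 2 ≤ L) (hk : 1 ≤ k)
    (M : Fin d → ℕ) [∀ μ, NeZero (M μ)] (φ : Tor M → ℝ) :
    0 ≤ φ ⬝ᵥ (effLaplacian (L ^ k) M (aK a L k) (((L ^ k : ℕ) : ℝ) ^ 2) m2 *ᵥ φ) := by
  have hL1 : (1 : ℝ) < L := by exact_mod_cast hL
  have hN₁ : 1 ≤ L ^ k := Nat.one_le_pow k L (by omega)
  have ha₁ : 0 < aK a L k := aK_pos ha hL1 hk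
  have hcard : (0 : ℝ) < Fintype.card (Tor M) := by exact_mod_cast Fintype.card_pos
  have hform := effLaplacian_form_DeltaEff (L ^ k) M hN₁ ha₁ hm φ
  have hsum : 0 ≤ ∑ q : Tor M, DeltaEff (aK a L k) (L ^ k) m2 (sOf M q) * ‖ft M φ q‖ ^ 2 :=
    Finset.sum_nonneg fun q _ => mul_nonneg (levelSymbol_pos_le_zone ha hL hm.le (sOf M q) hk).1.le (by positivity)
  rw [← hform] at hsum
  exact (mul_nonneg_iff_of_pos_left hcard).mp hsum

/-- **THE RELATIVE TWO-RUN RATE OF THE QUADRATIC FORMS**: for `L ≥ 2`, `k, n ≥ 1`, `a > 0`, `m² > 0`, every torus and every `φ`,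
`|⟨φ,Δ^{(k)}φ⟩ − ⟨φ,Δ^{(k+n)}φ⟩| ≤ θ̄·L^{−2k}·⟨φ,Δ^{(k)}φ⟩` — (4.35) for both runs and the mode-by-mode relative rate `abs_DeltaEff_sub_le_rel` ((3.92)'s mechanism).
[cite: King1986, (3.92) p.669, (4.35) p.674, Lemma 4.3 (4.18) p.672] -/
theorem effLaplacian_form_twoRun_le {a m2 : ℝ} (ha : 0 < a) (hm : 0 < m2) {L k n : ℕ} [NeZero L] (hL : 2 ≤ L) (hk : 1 ≤ k) (hn : 1 ≤ n)
    (M : Fin d → ℕ) [∀ μ, NeZero (M μ)] (φ : Tor M → ℝ) :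
    |φ ⬝ᵥ (effLaplacian (L ^ k) M (aK a L k) (((L ^ k : ℕ) : ℝ) ^ 2) m2 *ᵥ φ)
        - φ ⬝ᵥ (effLaplacian (L ^ (k + n)) M (aK a L (k + n)) (((L ^ (k + n) : ℕ) : ℝ) ^ 2) m2 *ᵥ φ)|
      ≤ thetaBar a L * (((L : ℝ) ^ k) ^ 2)⁻¹ * (φ ⬝ᵥ (effLaplacian (L ^ k) M (aK a L k) (((L ^ k : ℕ) : ℝ) ^ 2) m2 *ᵥ φ)) := by
  have hL1 : (1 : ℝ) < L := by exact_mod_cast hL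
  have hN₁ : 1 ≤ L ^ k := Nat.one_le_pow k L (by omega)
  have hN₀ : 1 ≤ L ^ (k + n) := Nat.one_le_pow (k + n) L (by omega)
  have ha₁ : 0 < aK a L k := aK_pos ha hL1 hk
  have ha₀ : 0 < aK a L (k + n) := aK_pos ha hL1 (by omega)
  have hcard : (0 : ℝ) < Fintype.card (Tor M) := by exact_mod_cast Fintype.card_pos
  set F₁ : ℝ := φ ⬝ᵥ (effLaplacian (L ^ k) M (aK a L k) (((L ^ k : ℕ) : ℝ) ^ 2) m2 *ᵥ φ) with hF₁
  set F₀ : ℝ := φ ⬝ᵥ (effLaplacian (L ^ (k + n)) M (aK a L (k + n)) (((L ^ (k + n) : ℕ) : ℝ) ^ 2) m2 *ᵥ φ) with hF₀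
  have h₁ := effLaplacian_form_DeltaEff (L ^ k) M hN₁ ha₁ hm φ
  have h₀ := effLaplacian_form_DeltaEff (L ^ (k + n)) M hN₀ ha₀ hm φ
  set θ : ℝ := thetaBar a L * (((L : ℝ) ^ k) ^ 2)⁻¹ with hθ
  have hθ0 : 0 ≤ θ := by
    rw [hθ]; unfold thetaBar; have := (inv_pos.mpr (aminL_pos ha hL)).le; positivity
  -- `|Ω|·|F₁ − F₀| ≤ θ·|Ω|·F₁`
  have hmain : (Fintype.card (Tor M) : ℝ) * |F₁ - F₀| ≤ (Fintype.card (Tor M) : ℝ) * (θ * F₁) := by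
    have e : (Fintype.card (Tor M) : ℝ) * |F₁ - F₀| = |(Fintype.card (Tor M) : ℝ) * F₁ - (Fintype.card (Tor M) : ℝ) * F₀| := by
      rw [← mul_sub, abs_mul, abs_of_pos hcard]
    rw [e, h₁, h₀, ← Finset.sum_sub_distrib]
    calc |∑ q : Tor M, (DeltaEff (aK a L k) (L ^ k) m2 (sOf M q) * ‖ft M φ q‖ ^ 2
            - DeltaEff (aK a L (k + n)) (L ^ (k + n)) m2 (sOf M q) * ‖ft M φ q‖ ^ 2)|
        ≤ ∑ q : Tor M, |DeltaEff (aK a L k) (L ^ k) m2 (sOf M q) * ‖ft M φ q‖ ^ 2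
            - DeltaEff (aK a L (k + n)) (L ^ (k + n)) m2 (sOf M q) * ‖ft M φ q‖ ^ 2| := Finset.abs_sum_le_sum_abs _ _
      _ ≤ ∑ q : Tor M, θ * (DeltaEff (aK a L k) (L ^ k) m2 (sOf M q) * ‖ft M φ q‖ ^ 2) := by
          refine Finset.sum_le_sum fun q _ => ?_
          rw [← sub_mul, abs_mul, abs_of_nonneg (by positivity : (0 : ℝ) ≤ ‖ft M φ q‖ ^ 2)]
          have hq := abs_DeltaEff_sub_le_rel ha hL hk hn hm (fun μ => abs_sOf_le M q μ)
          calc |DeltaEff (aK a L k) (L ^ k) m2 (sOf M q) - DeltaEff (aK a L (k + n)) (L ^ (k + n)) m2 (sOf M q)| * ‖ft M φ q‖ ^ 2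
              ≤ θ * DeltaEff (aK a L k) (L ^ k) m2 (sOf M q) * ‖ft M φ q‖ ^ 2 := mul_le_mul_of_nonneg_right hq (by positivity)
            _ = θ * (DeltaEff (aK a L k) (L ^ k) m2 (sOf M q) * ‖ft M φ q‖ ^ 2) := by ring
      _ = θ * ((Fintype.card (Tor M) : ℝ) * F₁) := by rw [← Finset.mul_sum, h₁]
      _ = (Fintype.card (Tor M) : ℝ) * (θ * F₁) := by ring
  exact le_of_mul_le_mul_left hmain hcard

/-- **THE HEIGHT-FREE REFERENCE OPERATOR — hypothesis-free, on every unit torus.**  For `a > 0`, `m² > 0`, `L ≥ 2` and every torus `Ω = Π_μ ℤ∕M_μ` there is ONE real matrix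
`Δ^{(∞)}` on `Ω` such that, writing `Δ^{(k)} = effLaplacian (L^k) M a_k L^{2k} m²` for King's level-`k` effective Laplacian and `θ̄ = thetaBar a L`:
(i) `Δ^{(∞)}` is symmetric; (ii) `Δ^{(k)}(z,w) → Δ^{(∞)}(z,w)` for all `z, w`; (iii) `|Δ^{(k)}(z,w) − Δ^{(∞)}(z,w)| ≤ θ̄·a·L^{−2k}` for every `k ≥ 1`;
(iv) `⟨φ,Δ^{(k)}φ⟩ → ⟨φ,Δ^{(∞)}φ⟩` and (v) `0 ≤ ⟨φ,Δ^{(∞)}φ⟩` for every `φ`; (vi) `|⟨φ,Δ^{(k)}φ⟩ − ⟨φ,Δ^{(∞)}φ⟩| ≤ θ̄·L^{−2k}·⟨φ,Δ^{(k)}φ⟩` for every `k ≥ 1`, `φ` —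
each level's operator is within `O(L^{−2k})` of a SINGLE run-independent reference: [King1986] Prop. 3.10 ∕ (3.92) in the REFERENCE FORM of the K1a display row (R1)
(`KernelRefOwnΦ` against a height-free `Ψ`), at the propagator∕covariance layer of the flat `A = 0` template.
[cite: King1986, Prop. 3.10 (3.91)-(3.92) p.669; Prop. 3.6 (3.56) p.662 with (3.58)-(3.61) p.663; Lemma 4.3 (4.18) p.672] -/
theorem exists_heightFree_operator {a m2 : ℝ} (ha : 0 < a) (hm : 0 < m2) {L : ℕ} [NeZero L] (hL : 2 ≤ L) (M : Fin d → ℕ) [∀ μ, NeZero (M μ)] :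
    ∃ Δinf : Matrix (Tor M) (Tor M) ℝ,
      (∀ z w, Δinf w z = Δinf z w) ∧
      (∀ z w, Tendsto (fun k : ℕ => effLaplacian (L ^ k) M (aK a L k) (((L ^ k : ℕ) : ℝ) ^ 2) m2 z w) atTop (𝓝 (Δinf z w))) ∧
      (∀ k : ℕ, 1 ≤ k → ∀ z w, |effLaplacian (L ^ k) M (aK a L k) (((L ^ k : ℕ) : ℝ) ^ 2) m2 z w - Δinf z w| ≤ thetaBar a L * a * (((L : ℝ) ^ k) ^ 2)⁻¹) ∧
      (∀ φ : Tor M → ℝ, Tendsto (fun k : ℕ => φ ⬝ᵥ (effLaplacian (L ^ k) M (aK a L k) (((L ^ k : ℕ) : ℝ) ^ 2) m2 *ᵥ φ)) atTop (𝓝 (φ ⬝ᵥ (Δinf *ᵥ φ)))) ∧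
      (∀ φ : Tor M → ℝ, 0 ≤ φ ⬝ᵥ (Δinf *ᵥ φ)) ∧
      (∀ k : ℕ, 1 ≤ k → ∀ φ : Tor M → ℝ,
        |φ ⬝ᵥ (effLaplacian (L ^ k) M (aK a L k) (((L ^ k : ℕ) : ℝ) ^ 2) m2 *ᵥ φ) - φ ⬝ᵥ (Δinf *ᵥ φ)|
          ≤ thetaBar a L * (((L : ℝ) ^ k) ^ 2)⁻¹ * (φ ⬝ᵥ (effLaplacian (L ^ k) M (aK a L k) (((L ^ k : ℕ) : ℝ) ^ 2) m2 *ᵥ φ))) := by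
  have hL1 : (1 : ℝ) < L := by exact_mod_cast hL
  have hr1 : ((L : ℝ) ^ 2)⁻¹ < 1 := inv_lt_one_of_one_lt₀ (by nlinarith)
  have hpw : ∀ k : ℕ, (((L : ℝ) ^ k) ^ 2)⁻¹ = (((L : ℝ) ^ 2)⁻¹) ^ k := fun k => by rw [← pow_mul, mul_comm, pow_mul, inv_pow]
  -- entrywise limits
  have hentry : ∀ z w : Tor M, ∃ x : ℝ,
      Tendsto (fun k : ℕ => effLaplacian (L ^ k) M (aK a L k) (((L ^ k : ℕ) : ℝ) ^ 2) m2 z w) atTop (𝓝 x) ∧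
      ∀ k : ℕ, 1 ≤ k → |effLaplacian (L ^ k) M (aK a L k) (((L ^ k : ℕ) : ℝ) ^ 2) m2 z w - x| ≤ thetaBar a L * a * (((L : ℝ) ^ k) ^ 2)⁻¹ := by
    intro z w
    exact exists_limit_of_uniform_cauchy (s := fun k : ℕ => effLaplacian (L ^ k) M (aK a L k) (((L ^ k : ℕ) : ℝ) ^ 2) m2 z w)
      (b := fun k => thetaBar a L * a * (((L : ℝ) ^ k) ^ 2)⁻¹) (C := thetaBar a L * a) (r := ((L : ℝ) ^ 2)⁻¹) hr1
      (fun k _ => by rw [hpw k]) (fun k n hk hn => effLaplacian_twoRun_apply_le ha hm hL hk hn M z w)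
  choose Δ hΔt hΔr using hentry
  refine ⟨fun z w => Δ z w, ?_, hΔt, fun k hk z w => hΔr z w k hk, ?_, ?_, ?_⟩
  · -- symmetry of the limit
    intro z w
    refine limit_unique (hΔt w z) ?_
    have h := hΔt z w
    refine h.congr fun k => ?_
    exact (effLaplacian_symm (L ^ k) M _ _ _ z w).symm
  · intro φ
    exact tendsto_dotProduct_mulVec (T := fun k : ℕ => effLaplacian (L ^ k) M (aK a L k) (((L ^ k : ℕ) : ℝ) ^ 2) m2) (Tinf := fun z w => Δ z w) hΔt φ φ
  · intro φ
    have ht := tendsto_dotProduct_mulVec (T := fun k : ℕ => effLaplacian (L ^ k) M (aK a L k) (((L ^ k : ℕ) : ℝ) ^ 2) m2) (Tinf := fun z w => Δ z w) hΔt φ φ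
    exact ge_of_tendsto ht (by filter_upwards [eventually_ge_atTop 1] with k hk; exact effLaplacian_form_nonneg ha hm hL hk M φ)
  · intro k hk φ
    have ht := tendsto_dotProduct_mulVec (T := fun k : ℕ => effLaplacian (L ^ k) M (aK a L k) (((L ^ k : ℕ) : ℝ) ^ 2) m2) (Tinf := fun z w => Δ z w) hΔt φ φ
    -- pass to the limit `n → ∞` in the relative two-run form bound
    have hidx : Tendsto (fun n : ℕ => k + n) atTop atTop :=
      tendsto_atTop_atTop.mpr fun b => ⟨b, fun n hn => hn.trans (Nat.le_add_left n k)⟩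
    have hshift : Tendsto (fun n : ℕ => φ ⬝ᵥ (effLaplacian (L ^ (k + n)) M (aK a L (k + n)) (((L ^ (k + n) : ℕ) : ℝ) ^ 2) m2 *ᵥ φ)) atTop
        (𝓝 (φ ⬝ᵥ ((fun z w => Δ z w : Matrix (Tor M) (Tor M) ℝ) *ᵥ φ))) := ht.comp hidx
    have habs := (tendsto_const_nhds (x := φ ⬝ᵥ (effLaplacian (L ^ k) M (aK a L k) (((L ^ k : ℕ) : ℝ) ^ 2) m2 *ᵥ φ))).sub hshift
    refine le_of_tendsto habs.abs ?_
    filter_upwards [eventually_ge_atTop 1] with n hn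
    exact effLaplacian_form_twoRun_le ha hm hL hk hn M φ

end Operators

end Summit.QuantumFields.YangMills.Theorems.TwoCutoffOperatorHeightFree

end
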